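import Summits.BirchSwinnertonDyer.BirchSwinnertonDyer.Theorems.QuadraticBranchSignedControlPlusEtaNonsurjQuarticTwistGalois
import HarnessLib

/-!
# Route `QuadraticBranchSignedControl` (rung K8, cell `bsd-potss`): crux stmt-BirchSwinnertonDyer-19606
# `PlusEtaMainConjectureNonsurj` — THE SEXTIC DOOR, PART I (Galois side): every curve with `j = 0` is `ℚ̄`-isomorphic to `y² = x³ + 1`
# equivariantly up to an automorphism of order dividing `6` on `Gal(ℚ̄/ℚ(ζ₃))`; the `2 × 2` lemmas `M³ = −1 ⟹ M = −1 ∨ M² = M − 1` and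
# `tr(F)² − tr(F) tr(MF) + tr(MF)² = 3 det F`

WHY. The three doors of k8eta-c2 g14/g15 — nine Frobenius primes (`h(K_V) > 1`), the `±` twist door (anchors with `j ∉ {0, 1728}`,
`…TwistedCongruenceTrace`), the quartic door (`j = 1728`, `…QuarticTwistDoor`) — decide every row of crux 19606 except those whose Cartan
field is `ℚ(√−3)` and whose possible CM anchors include the curves with `j = 0`, i.e. the SEXTIC twists `y² = x³ + B` of `E₀' : y² = x³ + 1`
(`Aut = μ₆`). Such a row exists in-table: `4P` on `X_ns⁺(11)` (`K_V = ℚ(√−3)`, Dose–Fernández–González–Schoof's `[−4]P`; the printed `j`-map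
formula is `0/0` there, which is why g15's table missed it). This file is the Galois side of the sextic analogue of the quartic door: along a
`ℚ̄`-isomorphism `A ≅ E₀'` (`u⁶ = B`) an element `σ ∈ Γ_ℚ` FIXING `ζ₃` is transported up to an automorphism `θ` of `E₀'` with `θ³ = ±1`
(`θ(x, y) = (ζ⁻²x, ζ⁻³y)`, `ζ ∈ μ₆`), and for `2 × 2` matrices over a field in which `−3` is not a square (`𝔽_p`, `p ≡ 2 (mod 3)`):
`M³ = −1 ⟹ M = −1 ∨ (M² = M − 1 ∧ tr M = 1)`, and `M² = M − 1`, `tr M = 1`, `MF = FM ⟹ tr(F)² − tr(F)·tr(MF) + tr(MF)² = 3·det F`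
(`F ∈ K[M] ≅ K[ρ]`, `ρ² = ρ − 1`: the norm form of `ℤ[ρ]`). Part II (`…SexticTwistDoor`): `V[p] ≅ A[p]`, `j(A) = 0`, `p ≡ 2 (mod 3)`,
`ℓ ≡ 1 (mod 3)` good for `V` ⟹ `a_ℓ(V)² ≡ t²` or `a_ℓ(V)² ∈ {x², (x − t)²}` for an `x ∈ 𝔽_p` with `x² − tx + t² = 3ℓ`, `t = a_ℓ(E₀')` — Gauss's
six values `±L, ±(L ± 9M)/2` (`4ℓ = L² + 27M²`) for the sextic twists of `y² = x³ + 1`, read modulo `p` through the congruence.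

* §1 `eq_neg_one_or_of_pow_three_eq_neg_one`, `trace_identity_of_mul_self_eq_sub_one` (2 × 2 matrices);
* §2 `iso_smul_of_smul_eq_mul` (the Galois behaviour of a `ℚ̄`-isomorphism `(u, 0, 0, 0)` when `σ u = ζ·u`, for ANY automorphism
  `(ζ, 0, 0, 0)` of the target — generalises the Deuring file's `iso_smul` (`ζ = 1`) and g15's `iso_smul_quartic` (`ζ = i`)),
  `theta_pow_three_of_pow_three_eq_one` / `theta_pow_three_of_pow_three_eq_neg_one` (`θ_ζ³ = ±1` for `ζ³ = ±1`);
* §3 **`exists_iso_of_j_eq_zero`**.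

HONEST FRAMING (cell `bsd-potss`, run/shared/lean/pub/bsd-potss/; FULL-BSD rank ≤ 1 programme): TOOL THEOREMS ONLY (no definition,
no named fact, no `sorry`, axioms standard). Nothing is booked; crux 19606 stays OPEN. Seat `bsd-potss-k8eta-c2` g16 (prover),
`--supports stmt-BirchSwinnertonDyer-19606`.

References: [SilvermanAEC2009] X.5 Prop. 5.4 (iii) and Cor. 5.4.1 (twists by `Aut(E) = μ₆` for `j = 0`), III.10 Thm. 10.1; [IrelandRosen1990]
Ch. 18 §3 Thm. 4 (`#E(𝔽_p)` for `y² = x³ + D`); [Serre1981] §8.1.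
-/

set_option autoImplicit false
set_option linter.dupNamespace false

noncomputable section

open scoped Classical NumberField

open Field IsDedekindDomain NumberField WeierstrassCurve Literature.NumberTheory.EllipticCurves
  Literature.NumberTheory.GaloisRepresentations Rat.HeightOneSpectrum
open Literature.NumberTheory.EllipticCurves.DeuringLadic
open scoped Matrix

namespace Summit.BirchSwinnertonDyer.BirchSwinnertonDyer.Theorems.EtaCartanField

/-! ## §1 The `2 × 2` lemmas for a matrix with `M³ = −1` over a field in which `−3` is not a square -/

/-- **`M³ = −1` over a field with `−3` a non-square.** For a `2 × 2` matrix `M` over a field `K` with `¬ IsSquare (−3 : K)`: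
if `M³ = −1` then either `M = −1`, or `M² = M − 1` and `tr M = 1` (Cayley–Hamilton: `M³ = (s² − δ)M − sδ` with `s = tr M`, `δ = det M`;
if `s² ≠ δ` then `M` is scalar with `λ³ = −1`, and `λ² − λ + 1 = 0` would make `(2λ − 1)² = −3`; if `s² = δ` then `s³ = 1` and
`s² + s + 1 = 0` would make `(2s + 1)² = −3`). [folklore] -/
theorem eq_neg_one_or_of_pow_three_eq_neg_one {K : Type*} [Field K] {M : Matrix (Fin 2) (Fin 2) K}
    (hM : M * M * M = -1) (hK : ¬ IsSquare (-3 : K)) :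
    M = -1 ∨ (M * M = M - 1 ∧ M.trace = 1) := by
  obtain ⟨a, b, c, d, rfl⟩ : ∃ a b c d : K, M = !![a, b; c, d] :=
    ⟨M 0 0, M 0 1, M 1 0, M 1 1, by ext i j; fin_cases i <;> fin_cases j <;> rfl⟩
  have m00 := congrFun (congrFun hM 0) 0
  have m01 := congrFun (congrFun hM 0) 1
  have m10 := congrFun (congrFun hM 1) 0
  have m11 := congrFun (congrFun hM 1) 1
  simp only [Matrix.mul_apply, Fin.sum_univ_two, Matrix.of_apply, Matrix.cons_val', Matrix.cons_val_zero,
    Matrix.cons_val_one, Matrix.cons_val_fin_one, Matrix.neg_apply, Matrix.one_apply_eq, Matrix.one_apply_ne,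
    ne_eq, zero_ne_one, one_ne_zero, not_false_eq_true, neg_zero] at m00 m01 m10 m11
  -- Cayley–Hamilton form of the four entries of `M³ + 1 = 0`
  have hb : ((a + d) ^ 2 - (a * d - b * c)) * b = 0 := by linear_combination m01
  have hc : ((a + d) ^ 2 - (a * d - b * c)) * c = 0 := by linear_combination m10
  have ha : ((a + d) ^ 2 - (a * d - b * c)) * a - (a + d) * (a * d - b * c) + 1 = 0 := by linear_combination m00
  have hd : ((a + d) ^ 2 - (a * d - b * c)) * d - (a + d) * (a * d - b * c) + 1 = 0 := by linear_combination m11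
  by_cases hsd : (a + d) ^ 2 - (a * d - b * c) = 0
  · -- `s² = δ`: then `sδ = 1`, `s³ = 1`, `s = 1`, `δ = 1`
    right
    have hsδ : (a + d) * (a * d - b * c) = 1 := by linear_combination -ha + a * hsd
    have hs3 : ((a + d) - 1) * ((a + d) ^ 2 + (a + d) + 1) = 0 := by
      linear_combination (a + d) * hsd + hsδ
    have hs1 : a + d = 1 := by
      rcases mul_eq_zero.mp hs3 with h1 | h2
      · exact sub_eq_zero.mp h1
      · exact absurd ⟨2 * (a + d) + 1, by linear_combination (-4 : K) * h2⟩ hK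
    have hδ1 : a * d - b * c = 1 := by linear_combination -hsd + ((a + d) + 1) * hs1
    refine ⟨?_, by rw [Matrix.trace_fin_two_of]; exact hs1⟩
    ext i j
    fin_cases i <;> fin_cases j <;>
      simp only [Matrix.mul_apply, Fin.sum_univ_two, Matrix.of_apply, Matrix.cons_val', Matrix.cons_val_zero,
        Matrix.cons_val_one, Matrix.cons_val_fin_one, Matrix.sub_apply, Matrix.one_apply_eq, Matrix.one_apply_ne,
        ne_eq, zero_ne_one, one_ne_zero, not_false_eq_true, sub_zero, Fin.zero_eta, Fin.mk_one, Fin.isValue]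
    · linear_combination a * hs1 - hδ1
    · linear_combination b * hs1
    · linear_combination c * hs1
    · linear_combination d * hs1 - hδ1
  · -- `s² ≠ δ`: `b = c = 0`, `a = d = λ` with `λ³ = −1`, hence `λ = −1`
    left
    have hb0 : b = 0 := by
      rcases mul_eq_zero.mp hb with h | h
      · exact absurd h hsd
      · exact h
    have hc0 : c = 0 := by
      rcases mul_eq_zero.mp hc with h | h
      · exact absurd h hsd
      · exact h
    have had : a = d := by
      have : ((a + d) ^ 2 - (a * d - b * c)) * (a - d) = 0 := by linear_combination ha - hd
      rcases mul_eq_zero.mp this with h | h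
      · exact absurd h hsd
      · exact sub_eq_zero.mp h
    subst had; subst hb0; subst hc0
    have ha3 : (a + 1) * (a ^ 2 - a + 1) = 0 := by linear_combination m00
    have ha1 : a = -1 := by
      rcases mul_eq_zero.mp ha3 with h1 | h2
      · exact eq_neg_of_add_eq_zero_left h1
      · exact absurd ⟨2 * a - 1, by linear_combination (-4 : K) * h2⟩ hK
    subst ha1
    ext i j
    fin_cases i <;> fin_cases j <;>
      simp [Matrix.of_apply, Matrix.cons_val', Matrix.cons_val_zero, Matrix.cons_val_one, Matrix.cons_val_fin_one,
        Matrix.neg_apply, Matrix.one_apply_eq, Matrix.one_apply_ne]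

/-- **Trace identity for `M² = M − 1`.** Over a field `K` in which `−3` is not a square, if `M² = M − 1`, `tr M = 1` and `MF = FM`
(`2 × 2` matrices) then `tr(F)² − tr(F)·tr(MF) + tr(MF)² = 3·det F` (`M` is not scalar, so `F ∈ K[M]`; for `F = α + βM`:
`tr F = 2α + β`, `tr(MF) = α − β`, `det F = α² + αβ + β²`). [folklore] -/
theorem trace_identity_of_mul_self_eq_sub_one {K : Type*} [Field K] {M F : Matrix (Fin 2) (Fin 2) K}
    (hM : M * M = M - 1) (htr : M.trace = 1) (hK : ¬ IsSquare (-3 : K)) (hMF : M * F = F * M) :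
    F.trace ^ 2 - F.trace * (M * F).trace + (M * F).trace ^ 2 = 3 * F.det := by
  obtain ⟨a, b, c, d, rfl⟩ : ∃ a b c d : K, M = !![a, b; c, d] :=
    ⟨M 0 0, M 0 1, M 1 0, M 1 1, by ext i j; fin_cases i <;> fin_cases j <;> rfl⟩
  obtain ⟨e, f, g, h, rfl⟩ : ∃ e f g h : K, F = !![e, f; g, h] :=
    ⟨F 0 0, F 0 1, F 1 0, F 1 1, by ext i j; fin_cases i <;> fin_cases j <;> rfl⟩
  rw [Matrix.trace_fin_two_of] at htr
  have hd : d = 1 - a := by linear_combination htr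
  subst hd
  have m00 := congrFun (congrFun hM 0) 0
  have k00 := congrFun (congrFun hMF 0) 0
  have k01 := congrFun (congrFun hMF 0) 1
  have k10 := congrFun (congrFun hMF 1) 0
  simp only [Matrix.mul_apply, Fin.sum_univ_two, Matrix.of_apply, Matrix.cons_val', Matrix.cons_val_zero,
    Matrix.cons_val_one, Matrix.cons_val_fin_one, Matrix.sub_apply, Matrix.one_apply_eq] at m00 k00 k01 k10
  -- `M` is not scalar: `b = c = 0` would give `a² − a + 1 = 0`, `(2a − 1)² = −3`
  have hbc : b ≠ 0 ∨ c ≠ 0 := by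
    by_contra h0
    simp only [not_or, not_not] at h0
    obtain ⟨hb, hc⟩ := h0
    exact hK ⟨2 * a - 1, by linear_combination (-4 : K) * m00 + 4 * c * hb⟩
  simp only [Matrix.mul_fin_two, Matrix.trace_fin_two_of, Matrix.det_fin_two_of]
  rcases hbc with hb | hc
  · -- `b ≠ 0`: `g`, `h`, `c` are determined by `a, b, e, f` through the commutation relations and `a² + bc = a − 1`
    have hg : g = f * c / b := by field_simp; linear_combination k00
    have hh : h = e + f * (1 - 2 * a) / b := by field_simp; linear_combination k01
    have hc' : c = (a - 1 - a * a) / b := by field_simp; linear_combination m00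
    rw [hg, hh]
    rw [hc']
    field_simp
    ring
  · -- `c ≠ 0`: symmetric
    have hf : f = g * b / c := by field_simp; linear_combination -k00
    have he : e = h + g * (2 * a - 1) / c := by field_simp; linear_combination k10
    have hb' : b = (a - 1 - a * a) / c := by field_simp; linear_combination m00
    rw [hf, he]
    rw [hb']
    field_simp
    ring

/-! ## §2 The automorphisms `θ_ζ(x, y) = (ζ⁻²x, ζ⁻³y)` and the Galois behaviour of `u` with `σ u = ζ u` -/

section PointLevel

variable {X E : WeierstrassCurve ℚ}

/-- **Galois behaviour of a `ℚ̄`-isomorphism `(u, 0, 0, 0)`, case `σ u = ζ·u`.** Let `C = (u, 0, 0, 0)` over `ℚ̄` with `C • X = E`,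
inducing `ι : X(ℚ̄) ≃ E(ℚ̄)`, `(x, y) ↦ (u⁻²x, u⁻³y)`, and `C_ζ = (ζ, 0, 0, 0)` with `C_ζ • E = E`, inducing the automorphism
`θ_ζ : (x, y) ↦ (ζ⁻²x, ζ⁻³y)` of `E(ℚ̄)`. If `σ u = ζ·u` then `θ_ζ (ι (σ P)) = σ (ι P)`. (For `ζ = 1` this is the Deuring file's `iso_smul`,
for `ζ = i` on `y² = x³ + a₄x` g15's `iso_smul_quartic`.) [cite: SilvermanAEC2009, X.5 Prop. 5.4 and III.10] -/
theorem iso_smul_of_smul_eq_mul (C : VariableChange (AlgebraicClosure ℚ))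
    (hC : C • X.baseChange (AlgebraicClosure ℚ) = E.baseChange (AlgebraicClosure ℚ))
    (hr : C.r = 0) (hs : C.s = 0) (ht : C.t = 0) {ζ : AlgebraicClosure ℚ}
    (CZ : VariableChange (AlgebraicClosure ℚ)) (hCZu : ((CZ.u : (AlgebraicClosure ℚ)ˣ) : AlgebraicClosure ℚ) = ζ)
    (hCZr : CZ.r = 0) (hCZs : CZ.s = 0) (hCZt : CZ.t = 0)
    (hCZ : CZ • E.baseChange (AlgebraicClosure ℚ) = E.baseChange (AlgebraicClosure ℚ))
    {σ : (AlgebraicClosure ℚ) ≃ₐ[ℚ] (AlgebraicClosure ℚ)} (hu : σ ((C.u : (AlgebraicClosure ℚ)ˣ) : AlgebraicClosure ℚ) = ζ * C.u)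
    (P : (X.baseChange (AlgebraicClosure ℚ)).toAffine.Point) :
    ((VariableChange.pointEquiv (E.baseChange (AlgebraicClosure ℚ)) CZ).trans (Affine.Point.congrEquiv hCZ))
      (((VariableChange.pointEquiv (X.baseChange (AlgebraicClosure ℚ)) C).trans (Affine.Point.congrEquiv hC)) (σ • P)) =
      σ • ((VariableChange.pointEquiv (X.baseChange (AlgebraicClosure ℚ)) C).trans (Affine.Point.congrEquiv hC)) P := by
  rcases P with _ | ⟨x, y, hxy⟩
  · rw [← Affine.Point.zero_def, smul_zero, map_zero, map_zero, smul_zero]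
  · obtain ⟨h1, e1⟩ := algEquiv_smul_some X σ hxy
    have e3 := pointEquiv_trans_congrEquiv_some C hC h1
    have e4 := pointEquiv_trans_congrEquiv_some C hC hxy
    rw [e1]
    erw [e3, e4]
    have e5 := pointEquiv_trans_congrEquiv_some CZ hCZ
      (hC ▸ (VariableChange.nonsingular_iff (X.baseChange (AlgebraicClosure ℚ)) C (σ x) (σ y)).mpr h1)
    erw [e5]
    obtain ⟨h2, e2⟩ := algEquiv_smul_some E σ
      (hC ▸ (VariableChange.nonsingular_iff (X.baseChange (AlgebraicClosure ℚ)) C x y).mpr hxy)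
    refine Eq.trans ?_ e2.symm
    congr 1
    · simp only [VariableChange.toX_def, Units.val_inv_eq_inv_val, hCZu, hCZr, hr, map_mul, map_pow, map_inv₀,
        hu, sub_zero]
      ring
    · simp only [VariableChange.toX_def, VariableChange.toY_def, Units.val_inv_eq_inv_val, hCZu, hCZr, hCZs, hCZt, hr, hs, ht,
        map_mul, map_pow, map_inv₀, hu, sub_zero, zero_mul]
      ring

/-- **`θ_ζ³ = 1` for `ζ³ = 1`**: the automorphism `θ_ζ : (x, y) ↦ (ζ⁻²x, ζ⁻³y)` of `E(ℚ̄)` (`C_ζ = (ζ, 0, 0, 0)`, `C_ζ • E = E`)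
satisfies `θ_ζ (θ_ζ (θ_ζ P)) = P` when `ζ³ = 1`. [cite: SilvermanAEC2009, III.10 Thm. 10.1] -/
theorem theta_pow_three_of_pow_three_eq_one {ζ : AlgebraicClosure ℚ} (hζ : ζ ^ 3 = 1)
    (CZ : VariableChange (AlgebraicClosure ℚ)) (hCZu : ((CZ.u : (AlgebraicClosure ℚ)ˣ) : AlgebraicClosure ℚ) = ζ)
    (hCZr : CZ.r = 0) (hCZs : CZ.s = 0) (hCZt : CZ.t = 0)
    (hCZ : CZ • E.baseChange (AlgebraicClosure ℚ) = E.baseChange (AlgebraicClosure ℚ))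
    (P : (E.baseChange (AlgebraicClosure ℚ)).toAffine.Point) :
    ((VariableChange.pointEquiv (E.baseChange (AlgebraicClosure ℚ)) CZ).trans (Affine.Point.congrEquiv hCZ))
      (((VariableChange.pointEquiv (E.baseChange (AlgebraicClosure ℚ)) CZ).trans (Affine.Point.congrEquiv hCZ))
        (((VariableChange.pointEquiv (E.baseChange (AlgebraicClosure ℚ)) CZ).trans (Affine.Point.congrEquiv hCZ)) P)) = P := by
  rcases P with _ | ⟨x, y, hxy⟩
  · rw [← Affine.Point.zero_def, map_zero, map_zero, map_zero]
  · have e4 := pointEquiv_trans_congrEquiv_some CZ hCZ hxy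
    erw [e4]
    have h5 := hCZ ▸ (VariableChange.nonsingular_iff (E.baseChange (AlgebraicClosure ℚ)) CZ x y).mpr hxy
    have e5 := pointEquiv_trans_congrEquiv_some CZ hCZ h5
    erw [e5]
    have e6 := pointEquiv_trans_congrEquiv_some CZ hCZ
      (hCZ ▸ (VariableChange.nonsingular_iff (E.baseChange (AlgebraicClosure ℚ)) CZ _ _).mpr h5)
    erw [e6]
    have hζi3 : ζ⁻¹ ^ 3 = 1 := by rw [inv_pow, hζ, inv_one]
    have hζi6 : ζ⁻¹ ^ 6 = 1 := by rw [show (6 : ℕ) = 3 * 2 by norm_num, pow_mul, hζi3, one_pow]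
    congr 1
    · simp only [VariableChange.toX_def, Units.val_inv_eq_inv_val, hCZu, hCZr, sub_zero]
      linear_combination x * hζi6
    · simp only [VariableChange.toX_def, VariableChange.toY_def, Units.val_inv_eq_inv_val, hCZu, hCZr, hCZs, hCZt,
        sub_zero, zero_mul]
      linear_combination (ζ⁻¹ ^ 6 * y + ζ⁻¹ ^ 3 * y + y) * hζi3

/-- **`θ_ζ³ = −1` for `ζ³ = −1`** (`E` with `a₁ = a₃ = 0`): `θ_ζ (θ_ζ (θ_ζ P)) = −P` when `ζ³ = −1` (e.g. `ζ` a primitive sixth root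
of unity: `θ_ζ` is the automorphism of order `6` of `y² = x³ + B`). [cite: SilvermanAEC2009, III.10 Thm. 10.1] -/
theorem theta_pow_three_of_pow_three_eq_neg_one (ha₁ : E.a₁ = 0) (ha₃ : E.a₃ = 0) {ζ : AlgebraicClosure ℚ} (hζ : ζ ^ 3 = -1)
    (CZ : VariableChange (AlgebraicClosure ℚ)) (hCZu : ((CZ.u : (AlgebraicClosure ℚ)ˣ) : AlgebraicClosure ℚ) = ζ)
    (hCZr : CZ.r = 0) (hCZs : CZ.s = 0) (hCZt : CZ.t = 0)
    (hCZ : CZ • E.baseChange (AlgebraicClosure ℚ) = E.baseChange (AlgebraicClosure ℚ))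
    (P : (E.baseChange (AlgebraicClosure ℚ)).toAffine.Point) :
    ((VariableChange.pointEquiv (E.baseChange (AlgebraicClosure ℚ)) CZ).trans (Affine.Point.congrEquiv hCZ))
      (((VariableChange.pointEquiv (E.baseChange (AlgebraicClosure ℚ)) CZ).trans (Affine.Point.congrEquiv hCZ))
        (((VariableChange.pointEquiv (E.baseChange (AlgebraicClosure ℚ)) CZ).trans (Affine.Point.congrEquiv hCZ)) P)) = -P := by
  rcases P with _ | ⟨x, y, hxy⟩
  · rw [← Affine.Point.zero_def, map_zero, map_zero, map_zero, neg_zero]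
  · have e4 := pointEquiv_trans_congrEquiv_some CZ hCZ hxy
    erw [e4]
    have h5 := hCZ ▸ (VariableChange.nonsingular_iff (E.baseChange (AlgebraicClosure ℚ)) CZ x y).mpr hxy
    have e5 := pointEquiv_trans_congrEquiv_some CZ hCZ h5
    erw [e5]
    have e6 := pointEquiv_trans_congrEquiv_some CZ hCZ
      (hCZ ▸ (VariableChange.nonsingular_iff (E.baseChange (AlgebraicClosure ℚ)) CZ _ _).mpr h5)
    erw [e6]
    rw [Affine.Point.neg_some]
    have hζi3 : ζ⁻¹ ^ 3 = -1 := by rw [inv_pow, hζ, inv_neg, inv_one]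
    have hζi6 : ζ⁻¹ ^ 6 = 1 := by rw [show (6 : ℕ) = 3 * 2 by norm_num, pow_mul, hζi3]; norm_num
    congr 1
    · simp only [VariableChange.toX_def, Units.val_inv_eq_inv_val, hCZu, hCZr, sub_zero]
      linear_combination x * hζi6
    · simp only [Affine.negY, VariableChange.toX_def, VariableChange.toY_def, Units.val_inv_eq_inv_val, hCZu, hCZr, hCZs, hCZt,
        sub_zero, zero_mul, baseChange, map_a₁, map_a₃, ha₁, ha₃, map_zero]
      linear_combination (ζ⁻¹ ^ 6 * y - ζ⁻¹ ^ 3 * y + y) * hζi3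

end PointLevel

/-! ## §3 Every curve with `j = 0` is `ℚ̄`-isomorphic to `E₀' : y² = x³ + 1`, equivariantly up to `Aut(E₀') = μ₆` on `Gal(ℚ̄/ℚ(ζ₃))` -/

/-- **Every elliptic curve over `ℚ` with `j = 0` is `ℚ̄`-isomorphic to `E₀' = [0,0,0,0,1]` (`y² = x³ + 1`), and for every `g ∈ Γ_ℚ`
FIXING `Z = ζ₆` (`Z² = Z − 1`) the isomorphism `ι` is equivariant up to an automorphism `θ` of `E₀'`**: `θ ∘ ι ∘ g = g ∘ ι` with
`θ = θ_ζ`, `ζ ∈ μ₆ = {±1, ±Z, ±Z²}` (so `θ³ = 1` or `θ³ = −1`), and `θ` commutes with every element of `Γ_ℚ` fixing `Z`. Construction: the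
short model `y² = x³ + B` of the curve (`toShortNF`, `a₄ = 0` by `j = 0`) and `u = α` with `α⁶ = B`; `g α = ζ α` with `ζ⁶ = 1`.
[cite: SilvermanAEC2009, X.5 Prop. 5.4 (iii) and Cor. 5.4.1, III.10 Thm. 10.1] -/
theorem exists_iso_of_j_eq_zero {W : WeierstrassCurve ℚ} [W.IsElliptic] (hj : W.j = 0)
    {Z : AlgebraicClosure ℚ} (hZ : Z ^ 2 = Z - 1) :
    ∃ (ι : W.geomPoints ≃+ (⟨0, 0, 0, 0, 1⟩ : WeierstrassCurve ℚ).geomPoints),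
      ∀ g : absoluteGaloisGroup ℚ, g • Z = Z →
        ∃ θ : (⟨0, 0, 0, 0, 1⟩ : WeierstrassCurve ℚ).geomPoints ≃+ (⟨0, 0, 0, 0, 1⟩ : WeierstrassCurve ℚ).geomPoints,
          (∀ g' : absoluteGaloisGroup ℚ, g' • Z = Z → ∀ P, θ (g' • P) = g' • θ P) ∧
          ((∀ P, θ (θ (θ P)) = P) ∨ (∀ P, θ (θ (θ P)) = -P)) ∧
          (∀ P, θ (ι (g • P)) = g • ι P) := by
  set E₀ : WeierstrassCurve ℚ := ⟨0, 0, 0, 0, 1⟩ with hE₀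
  have hZ3 : Z ^ 3 = -1 := by linear_combination (Z + 1) * hZ
  have hZ6 : Z ^ 6 = 1 := by rw [show (6 : ℕ) = 3 * 2 by norm_num, pow_mul, hZ3]; norm_num
  have hZ0 : Z ≠ 0 := by rintro rfl; norm_num at hZ3
  -- the short model `S₀ = [0,0,0,0,B]` of `W`
  have hjS : (W.toShortNF • W).j = 0 := by rw [variableChange_j, hj]
  have hS4 : (W.toShortNF • W).a₄ = 0 := by
    have hD := four_mul_a₄_cube_add_ne_zero (W.toShortNF • W)
    have h := hjS
    rw [j_of_isShortNF, div_eq_iff hD, zero_mul] at h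
    have h6912 : (6912 : ℚ) ≠ 0 := by norm_num
    simpa [h6912] using h
  have hS6 : (W.toShortNF • W).a₆ ≠ 0 := by
    intro h0
    apply four_mul_a₄_cube_add_ne_zero (W.toShortNF • W)
    rw [h0, hS4]; ring
  set B : ℚ := (W.toShortNF • W).a₆ with hB
  set S₀ : WeierstrassCurve ℚ := ⟨0, 0, 0, 0, B⟩ with hS₀
  have hSB : W.toShortNF • W = S₀ := by
    rw [hS₀]; ext
    · exact a₁_of_isShortNF _
    · exact a₂_of_isShortNF _
    · exact a₃_of_isShortNF _
    · exact hS4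
    · rfl
  -- `α⁶ = B`
  obtain ⟨α, hα⟩ := IsAlgClosed.exists_pow_nat_eq (algebraMap ℚ (AlgebraicClosure ℚ) B) (by norm_num : 0 < 6)
  have hα0 : α ≠ 0 := by
    rintro rfl
    rw [zero_pow (by norm_num), eq_comm, map_eq_zero] at hα
    exact hS6 hα
  set C₁ : VariableChange (AlgebraicClosure ℚ) := ⟨Units.mk0 α hα0, 0, 0, 0⟩ with hC₁def
  have hC₁inv : ((Units.mk0 α hα0)⁻¹ : (AlgebraicClosure ℚ)ˣ) = Units.mk0 α⁻¹ (inv_ne_zero hα0) := Units.ext (by simp)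
  have hC₁ : C₁ • S₀.baseChange (AlgebraicClosure ℚ) = E₀.baseChange (AlgebraicClosure ℚ) := by
    ext
    · simp [hC₁def, hE₀, hS₀, baseChange, variableChange_a₁]
    · simp [hC₁def, hE₀, hS₀, baseChange, variableChange_a₂]
    · simp [hC₁def, hE₀, hS₀, baseChange, variableChange_a₃]
    · simp [hC₁def, hE₀, hS₀, baseChange, variableChange_a₄]
    · simp only [hC₁def, hE₀, hS₀, variableChange_a₆, baseChange, map_a₁, map_a₂, map_a₃, map_a₄, map_a₆, hC₁inv, Units.val_mk0,
        map_zero, map_one, mul_zero, sub_zero, add_zero]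
      rw [← hα, inv_pow]
      field_simp
      ring
  let ι₁ : S₀.geomPoints ≃+ E₀.geomPoints :=
    (VariableChange.pointEquiv (S₀.baseChange (AlgebraicClosure ℚ)) C₁).trans (Affine.Point.congrEquiv hC₁)
  let ιW : W.geomPoints ≃+ S₀.geomPoints := twistPointsIso hSB
  have hιW : ∀ (g : absoluteGaloisGroup ℚ) (P : W.geomPoints), ιW (g • P) = g • ιW P := fun g P => twistPointsIso_smul hSB g P
  have hu : ((C₁.u : (AlgebraicClosure ℚ)ˣ) : AlgebraicClosure ℚ) = α := by simp [hC₁def]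
  have hr0 : C₁.r = 0 := rfl
  have hs0 : C₁.s = 0 := rfl
  have ht0 : C₁.t = 0 := rfl
  refine ⟨ιW.trans ι₁, fun g hg => ?_⟩
  -- the automorphism `θ_ζ` for a sixth root of unity `ζ` fixed by every `g'` fixing `Z`
  have key : ∀ ζ : AlgebraicClosure ℚ, ζ ^ 6 = 1 → (ζ ^ 3 = 1 ∨ ζ ^ 3 = -1) →
      (∀ g' : absoluteGaloisGroup ℚ, g' • Z = Z → g' • ζ = ζ) → g • α = ζ * α →
      ∃ θ : E₀.geomPoints ≃+ E₀.geomPoints,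
        (∀ g' : absoluteGaloisGroup ℚ, g' • Z = Z → ∀ P, θ (g' • P) = g' • θ P) ∧
        ((∀ P, θ (θ (θ P)) = P) ∨ (∀ P, θ (θ (θ P)) = -P)) ∧
        (∀ P, θ ((ιW.trans ι₁) (g • P)) = g • (ιW.trans ι₁) P) := by
    intro ζ hζ6 hζ3 hfix hgα
    have hζ0 : ζ ≠ 0 := by rintro rfl; norm_num at hζ6
    set CZ : VariableChange (AlgebraicClosure ℚ) := ⟨Units.mk0 ζ hζ0, 0, 0, 0⟩ with hCZdef
    have hCZinv : ((Units.mk0 ζ hζ0)⁻¹ : (AlgebraicClosure ℚ)ˣ) = Units.mk0 ζ⁻¹ (inv_ne_zero hζ0) := Units.ext (by simp)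
    have hCZ : CZ • E₀.baseChange (AlgebraicClosure ℚ) = E₀.baseChange (AlgebraicClosure ℚ) := by
      ext
      · simp [hCZdef, hE₀, baseChange, variableChange_a₁]
      · simp [hCZdef, hE₀, baseChange, variableChange_a₂]
      · simp [hCZdef, hE₀, baseChange, variableChange_a₃]
      · simp [hCZdef, hE₀, baseChange, variableChange_a₄]
      · simp only [hCZdef, hE₀, variableChange_a₆, baseChange, map_a₁, map_a₂, map_a₃, map_a₄, map_a₆, hCZinv, Units.val_mk0,
          map_zero, map_one, mul_zero, sub_zero, add_zero]
        rw [inv_pow, hζ6, inv_one, one_mul]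
        norm_num
    have hCZu : ((CZ.u : (AlgebraicClosure ℚ)ˣ) : AlgebraicClosure ℚ) = ζ := by simp [hCZdef]
    let θ : E₀.geomPoints ≃+ E₀.geomPoints :=
      (VariableChange.pointEquiv (E₀.baseChange (AlgebraicClosure ℚ)) CZ).trans (Affine.Point.congrEquiv hCZ)
    refine ⟨θ, fun g' hg' P => ?_, ?_, fun P => ?_⟩
    · have h0g : g' • (0 : AlgebraicClosure ℚ) = 0 := smul_zero g'
      exact iso_smul (X := E₀) (E := E₀) CZ hCZ (by rw [hCZu]; exact hfix g' hg') h0g h0g h0g P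
    · rcases hζ3 with h3 | h3
      · exact Or.inl fun P => theta_pow_three_of_pow_three_eq_one (E := E₀) h3 CZ hCZu rfl rfl rfl hCZ P
      · exact Or.inr fun P => theta_pow_three_of_pow_three_eq_neg_one (E := E₀) rfl rfl h3 CZ hCZu rfl rfl rfl hCZ P
    · change θ (ι₁ (ιW (g • P))) = g • ι₁ (ιW P)
      rw [hιW]
      exact iso_smul_of_smul_eq_mul C₁ hC₁ hr0 hs0 ht0 CZ hCZu rfl rfl rfl hCZ (by rw [hu]; exact hgα) _
  -- `g α = ζ α` with `ζ⁶ = 1`, i.e. `ζ ∈ {1, -1, Z, -Z, Z², -Z²}`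
  have hζ6 : (g • α) ^ 6 = α ^ 6 := by rw [← smul_pow', hα, smul_algebraMap]
  have hprod : ((g • α - α) * (g • α + α)) * (((g • α - Z * α) * (g • α + Z * α)) *
      ((g • α - Z ^ 2 * α) * (g • α + Z ^ 2 * α))) = 0 := by
    linear_combination hζ6 + (-(Z ^ 2 + Z + 1) * α ^ 2 * (g • α) ^ 4 + Z ^ 2 * (Z ^ 2 + Z + 1) * α ^ 4 * (g • α) ^ 2
      - (Z + 1) * (Z ^ 3 - 1) * α ^ 6) * hZ
  have hfix1 : ∀ g' : absoluteGaloisGroup ℚ, g' • Z = Z → g' • (1 : AlgebraicClosure ℚ) = 1 := fun g' _ => smul_one g'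
  have hfixZ2 : ∀ g' : absoluteGaloisGroup ℚ, g' • Z = Z → g' • Z ^ 2 = Z ^ 2 := fun g' hg' => by rw [smul_pow', hg']
  have hfixneg : ∀ w : AlgebraicClosure ℚ, (∀ g' : absoluteGaloisGroup ℚ, g' • Z = Z → g' • w = w) →
      ∀ g' : absoluteGaloisGroup ℚ, g' • Z = Z → g' • (-w) = -w := fun w hw g' hg' => by rw [smul_neg, hw g' hg']
  have hZ23 : (Z ^ 2) ^ 3 = 1 := by rw [← pow_mul]; exact hZ6
  rcases mul_eq_zero.mp hprod with h12 | h3456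
  · rcases mul_eq_zero.mp h12 with h1 | h2
    · exact key 1 (one_pow 6) (Or.inl (one_pow 3)) hfix1 (by rw [one_mul]; exact sub_eq_zero.mp h1)
    · exact key (-1) (by norm_num) (Or.inr (by norm_num)) (hfixneg 1 hfix1)
        (by rw [neg_one_mul]; exact add_eq_zero_iff_eq_neg.mp h2)
  · rcases mul_eq_zero.mp h3456 with h34 | h56
    · rcases mul_eq_zero.mp h34 with h3 | h4
      · exact key Z hZ6 (Or.inr hZ3) (fun g' hg' => hg') (sub_eq_zero.mp h3)
      · exact key (-Z) (by rw [neg_pow, hZ6]; norm_num) (Or.inl (by rw [neg_pow, hZ3]; norm_num)) (hfixneg Z fun g' hg' => hg')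
          (by rw [neg_mul]; exact add_eq_zero_iff_eq_neg.mp h4)
    · rcases mul_eq_zero.mp h56 with h5 | h6
      · exact key (Z ^ 2) (by rw [← pow_mul, show 2 * 6 = 6 * 2 from rfl, pow_mul, hZ6, one_pow]) (Or.inl hZ23) hfixZ2
          (sub_eq_zero.mp h5)
      · exact key (-(Z ^ 2)) (by rw [neg_pow, ← pow_mul, show 2 * 6 = 6 * 2 from rfl, pow_mul, hZ6]; norm_num)
          (Or.inr (by rw [neg_pow, hZ23]; norm_num)) (hfixneg (Z ^ 2) hfixZ2)
          (by rw [neg_mul]; exact add_eq_zero_iff_eq_neg.mp h6)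

end Summit.BirchSwinnertonDyer.BirchSwinnertonDyer.Theorems.EtaCartanField

end
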